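/-
Copyright (c) 2026 the pub-hodgecm-mathlib formalisation cell (harness21).  Prover seat hodgecm-mathlib-K2E3-p04 (g3), Track B ∕ K2-LIT
(build stream 29), h413 = `stmt-HodgeConjecture-24833`, line `K2_E3_EllipticInputs`, unit U4 «Keys» — brick (α) «DET-TWIST REDUCTION: THE REDUCIBILITY OF
`i_G(χ₁, χ₂)` DOES NOT DEPEND ON `χ₂`».  2026-09-04.
-/
import Summits.HodgeConjecture.HodgeConjecture.Theorems.F0P3cStCharTSStOneDim     -- ★ (F0P2-p06): `exists_detNormOne` (`det : U(Φ₃)(L⁺_v) →* E¹_v`, continuous), `isOpen_ker_comp`, `det_proj`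
import HarnessLib

/-!
# h413 ∕ Track B «K2-LIT», unit U4 «Keys», brick (α): TWISTING A PRINCIPAL SERIES OF `U(Φ₃)(L⁺_v)` BY `ψ ∘ det` — `i_G(χ₁, χ₂) ⊗ (ψ∘det_G) ≅ i_G(χ₁, χ₂ψ)`, so
# «`i_G(χ₁, χ₂)` is reducible» ⟺ «`i_G(χ₁, 1)` is reducible»   [Rogawski1990 §12.1–§12.2; BernsteinZelevinsky1977 §2.3; BushnellHenniart2006 §9.1]

Cell `pub/hodgecm-mathlib`, crux H413 = `stmt-HodgeConjecture-24833` (lane `--supports … --as helper`), route HCCMUnconditional; dealer K2E3-plan (g2) (this seat's offer (α) 03:2xZ,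
default after silence).  THEOREMS ONLY (0 def ∕ 0 instance ∕ 0 notation ∕ 0 sorry; the twist map is built INSIDE the proofs and the heads are existential ∕ iff in it); ★-only imports.
WHY.  U4-f `sig_K2E3KeysThmTwoContracting` binds an ARBITRARY continuous `χ₂ : E¹_v → ℂ^×` but concludes about `χ₁` alone, exactly as print does ([Rogawski1990, §12.2]:
«`i_G(χ)` is irreducible except … (1) `χ₁(α) = ‖α‖^{±1}` (2) `χ₁ = η‖·‖^{±1∕2}` (3) …», no condition on `χ₂`).  The reason is the tree's (= print's, [Rogawski1990, §12.1 p. 171])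
convention ★ `torusCharPair`: `χ(d) = χ₁(d₀₀) · χ₂(det d)`, so that `i_G(χ₁, χ₂ψ) = i_G(χ₁, χ₂) ⊗ (ψ ∘ det_G)` for every character `ψ` of `E¹_v`, and twisting by a character of `G`
does not change the lattice of `G`-subrepresentations.  Roads I ∕ II of the unit see only the `K_v`-SPHERICAL line, i.e. `χ` trivial on `T ∩ K_v`, which forces `χ₂ = 1`
(★ `apply_normOneUnits_eq_one_of_trivial`); this file reduces the general `χ₂` to that case.

* §1 GENERIC (`H ≤ G` topological, `σ, σ′ : H → GL(W)` with `σ′(h) = ψ(h)·σ(h)` for a character `ψ : G →* kˣ` with OPEN KERNEL): **`exists_twistEquiv`** — a `k`-linear equivalence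
  `Φ : Ind_H^G σ ≃ Ind_H^G σ′` with `(Φ f)(g) = ψ(g)·f(g)` (smoothness: `Stab(Φf) ⊇ Stab(f) ∩ ker ψ`); **`exists_ne_bot_ne_top_of_twist`** ∕ **`exists_ne_bot_ne_top_iff_of_twist`** — ANY
  linear equivalence with that formula satisfies `Φ(g·f) = ψ(g)⁻¹·(g·Φf)`, hence maps `G`-subrepresentations onto `G`-subrepresentations, `⊥ ↦ ⊥`, `⊤ ↦ ⊤`.
* §2 `U(Φ₃)(L⁺_v)`: **`reducible_iff_reducible_twist`** — for continuous `ψ : E¹_v →* ℂˣ`, `i_G(χ₁, χ₂)` has a proper non-zero `G`-subrepresentation iff `i_G(χ₁, χ₂·ψ)` has one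
  (`det_G` ★ `exists_detNormOne`, open kernel ★ `isOpen_ker_comp`, and on the Borel `χ₁(p₀₀)(χ₂ψ)(det p) δ^{1∕2}(p) = ψ(det p) · χ₁(p₀₀)χ₂(det p)δ^{1∕2}(p)` by ★ `det_proj`);
  **`reducible_iff_reducible_one`** — the case `ψ = χ₂⁻¹`: `i_G(χ₁, χ₂)` reducible ⟺ `i_G(χ₁, 1)` reducible.

HONEST LABEL.  HC_CM is proved only modulo the 7 printed citations (2 remaining named inputs: hLiu418 = `stmt-HodgeConjecture-24832`, h413 = `stmt-HodgeConjecture-24833`) until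
rung 0 closes; count-neutral (U4 helper: removes `χ₂` from U4-f's analysis).

## References
* [Rogawski1990] J. D. Rogawski, *Automorphic Representations of Unitary Groups in Three Variables*, Ann. of Math. Stud. 123 (1990), §12.1 p. 171 (characters `(χ₁, χ₂)` of `M`,
  `χ(d) = χ₁(α)χ₂(αᾱ⁻¹β)`), §12.2 p. 173 ((1): `JH(i_G(χ)) = {χ₂∘det_G, St_G(χ₂∘det)}`).
* [BernsteinZelevinsky1977] I. N. Bernstein, A. V. Zelevinsky, *Induced representations of reductive `p`-adic groups I*, Ann. Sci. ÉNS 10 (1977), §2.3, Prop. 1.9 (f)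
  (`Ind(σ ⊗ ψ|_H) = Ind(σ) ⊗ ψ`).
* [BushnellHenniart2006] C. J. Bushnell, G. Henniart, *The local Langlands conjecture for `GL(2)`* (2006), §1.5 (open kernels), §9.1 (twisting by `χ∘det`).
* [Keys1984] D. Keys, *Principal series representations of special unitary groups over local fields*, Compositio Math. 51 (1984), §7 (the list depends on `λ = χ|_{SU}` only).
-/

set_option autoImplicit false
-- the mandated namespace repeats the single-problem summit's segment (`HodgeConjecture.HodgeConjecture`)
set_option linter.dupNamespace false

noncomputable section

open NumberField IsDedekindDomain Topology
open scoped Matrix NNReal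

open Literature.NumberTheory.Automorphic Literature.NumberTheory.Automorphic.UnitaryGroup

namespace Summit.HodgeConjecture.HodgeConjecture.Cruxes.H413.K2E3PrincipalSeriesDetTwist

/-! ## §1 Generic: twisting a smooth induced representation by a character of `G` with open kernel -/

section Generic

open Representation

variable {k G W : Type*} [CommRing k] [Group G] [TopologicalSpace G] [IsTopologicalGroup G] [AddCommGroup W] [Module k W]
  (H : Subgroup G) {σ σ' : Representation k H W} (ψ : G →* kˣ)

/-- **THE TWIST MAP `f ↦ ψ·f` ON SMOOTH INDUCTION.**  For `σ, σ′ : H → GL(W)` with `σ′(h) = ψ(h)·σ(h)` and `ψ : G →* kˣ` with OPEN kernel there is a `k`-linear EQUIVALENCE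
`Φ : Ind_H^G σ ≃ Ind_H^G σ′` with `(Φ f)(g) = ψ(g) · f(g)` (equivariance: `ψ(hg) f(hg) = ψ(h)ψ(g) σ(h) f(g) = σ′(h)(ψ(g) f(g))`; smoothness: the stabiliser of `Φf` contains
`Stab(f) ∩ ker ψ`, open; inverse = the twist by `ψ⁻¹`). [cite: BernsteinZelevinsky1977, §2.3, Prop. 1.9 (f)] [cite: BushnellHenniart2006, §1.5; §9.1] -/
theorem exists_twistEquiv (hψ : IsOpen ((ψ.ker : Subgroup G) : Set G)) (hσ : ∀ (h : H) (w : W), σ' h w = ((ψ (h : G) : kˣ) : k) • σ h w) :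
    ∃ Φ : SmoothInd H σ ≃ₗ[k] SmoothInd H σ', ∀ (f : SmoothInd H σ) (g : G), (Φ f).toFun g = ((ψ g : kˣ) : k) • f.toFun g := by
  -- the twist by a character `θ` with open kernel, between any compatible pair
  have key : ∀ {τ τ' : Representation k H W} (θ : G →* kˣ), IsOpen ((θ.ker : Subgroup G) : Set G) →
      (∀ (h : H) (w : W), τ' h w = ((θ (h : G) : kˣ) : k) • τ h w) →
      ∃ T : SmoothInd H τ →ₗ[k] SmoothInd H τ', ∀ (f : SmoothInd H τ) (g : G), (T f).toFun g = ((θ g : kˣ) : k) • f.toFun g := by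
    intro τ τ' θ hθ hτ
    let tw : SmoothInd H τ → SmoothInd H τ' := fun f =>
      (⟨⟨fun g => ((θ g : kˣ) : k) • f.toFun g, (mem_indFun_iff H τ' _).2 fun h g => by
          rw [f.toFun_subgroup_mul, hτ, map_mul, Units.val_mul, mul_smul, map_smul, smul_comm]⟩,
        by
          have hopen : IsOpen (((indFun H τ).stabilizerSubgroup (show ↥(smoothInd H τ).toSubmodule from f).1 : Subgroup G) : Set G) :=
            (show ↥(smoothInd H τ).toSubmodule from f).2
          refine (indFun H τ').isSmoothVector_of_le
            (K := ((indFun H τ).stabilizerSubgroup (show ↥(smoothInd H τ).toSubmodule from f).1) ⊓ θ.ker) (hopen.inter hθ) fun κ hκ => ?_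
          rw [Subgroup.mem_inf, mem_stabilizerSubgroup, MonoidHom.mem_ker] at hκ
          rw [mem_stabilizerSubgroup]
          apply Subtype.ext
          funext x
          change ((θ (x * κ) : kˣ) : k) • f.toFun (x * κ) = ((θ x : kˣ) : k) • f.toFun x
          have := congrArg (fun u : coindV H.subtype τ => (u : G → W) x) hκ.1
          rw [map_mul, hκ.2, mul_one]
          congr 1⟩ : ↥(smoothInd H τ').toSubmodule)
    have htw : ∀ (f : SmoothInd H τ) (g : G), (tw f).toFun g = ((θ g : kˣ) : k) • f.toFun g := fun _ _ => rfl
    refine ⟨{ toFun := tw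
              map_add' := fun f f' => SmoothInd.ext (funext fun g => by rw [htw, SmoothInd.toFun_add, SmoothInd.toFun_add, Pi.add_apply, Pi.add_apply, htw, htw, smul_add])
              map_smul' := fun c f => SmoothInd.ext (funext fun g => by
                rw [htw, SmoothInd.toFun_smul, RingHom.id_apply, SmoothInd.toFun_smul, Pi.smul_apply, Pi.smul_apply, htw, smul_comm]) }, htw⟩
  have hσ' : ∀ (h : H) (w : W), σ h w = ((ψ⁻¹ (h : G) : kˣ) : k) • σ' h w := fun h w => by
    rw [hσ, MonoidHom.inv_apply, smul_smul, Units.inv_mul, one_smul]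
  have hψ' : IsOpen ((ψ⁻¹.ker : Subgroup G) : Set G) := by
    have : (ψ⁻¹.ker : Subgroup G) = ψ.ker := by ext g; simp [MonoidHom.mem_ker]
    rw [this]; exact hψ
  obtain ⟨T, hT⟩ := key ψ hψ hσ
  obtain ⟨S, hS⟩ := key ψ⁻¹ hψ' hσ'
  have hTS : T.comp S = LinearMap.id := LinearMap.ext fun f => SmoothInd.ext (funext fun g => by
    rw [LinearMap.comp_apply, LinearMap.id_apply, hT, hS, smul_smul, MonoidHom.inv_apply, Units.mul_inv, one_smul])
  have hST : S.comp T = LinearMap.id := LinearMap.ext fun f => SmoothInd.ext (funext fun g => by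
    rw [LinearMap.comp_apply, LinearMap.id_apply, hS, hT, smul_smul, MonoidHom.inv_apply, Units.inv_mul, one_smul])
  exact ⟨LinearEquiv.ofLinear T S hTS hST, fun f g => by rw [LinearEquiv.ofLinear_apply, hT]⟩

/-- **A twist map transports `G`-subrepresentations** (one direction).  If a linear equivalence `Φ : Ind_H^G σ ≃ Ind_H^G σ′` satisfies `(Φ f)(g) = ψ(g)·f(g)` then
`Φ(g·f) = ψ(g)⁻¹ · (g·Φf)` (both sides are `x ↦ ψ(x) f(xg)`), so the image of a `G`-subrepresentation is a `G`-subrepresentation, and `⊥`, `⊤` are preserved (`Φ` bijective):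
a proper non-zero `G`-subrepresentation of `Ind σ` yields one of `Ind σ′`. [cite: BushnellHenniart2006, §9.1] [cite: BernsteinZelevinsky1977, §2.3] -/
theorem exists_ne_bot_ne_top_of_twist (Φ : SmoothInd H σ ≃ₗ[k] SmoothInd H σ') (hΦ : ∀ (f : SmoothInd H σ) (g : G), (Φ f).toFun g = ((ψ g : kˣ) : k) • f.toFun g)
    (h : ∃ N : Subrepresentation (smoothIndRep H σ), N ≠ ⊥ ∧ N ≠ ⊤) :
    ∃ N' : Subrepresentation (smoothIndRep H σ'), N' ≠ ⊥ ∧ N' ≠ ⊤ := by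
  obtain ⟨N, hN0, hN1⟩ := h
  -- twisted equivariance
  have heq : ∀ (g : G) (f : SmoothInd H σ), smoothIndRep H σ' g (Φ f) = ((ψ g : kˣ) : k) • Φ (smoothIndRep H σ g f) := fun g f =>
    SmoothInd.ext (funext fun x => by
      rw [toFun_smoothIndRep_apply, hΦ, SmoothInd.toFun_smul, Pi.smul_apply, hΦ, toFun_smoothIndRep_apply, map_mul, Units.val_mul, mul_smul, smul_comm])
  refine ⟨⟨N.toSubmodule.map (Φ : SmoothInd H σ →ₗ[k] SmoothInd H σ'), fun g v hv => ?_⟩, ?_, ?_⟩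
  · obtain ⟨n, hn, rfl⟩ := Submodule.mem_map.1 hv
    rw [LinearEquiv.coe_coe, heq]
    exact Submodule.smul_mem _ _ (Submodule.mem_map.2 ⟨_, N.apply_mem_toSubmodule g hn, rfl⟩)
  · intro h0
    apply hN0
    have h0' : N.toSubmodule.map (Φ : SmoothInd H σ →ₗ[k] SmoothInd H σ') = ⊥ := congrArg Subrepresentation.toSubmodule h0
    apply Subrepresentation.toSubmodule_injective
    refine le_bot_iff.1 fun n hn => ?_
    have hmem : Φ n ∈ N.toSubmodule.map (Φ : SmoothInd H σ →ₗ[k] SmoothInd H σ') := Submodule.mem_map.2 ⟨n, hn, rfl⟩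
    rw [h0', Submodule.mem_bot] at hmem
    change n ∈ (⊥ : Submodule k (SmoothInd H σ))
    rw [Submodule.mem_bot]
    exact (LinearEquiv.map_eq_zero_iff Φ).1 hmem
  · intro h1
    apply hN1
    have h1' : N.toSubmodule.map (Φ : SmoothInd H σ →ₗ[k] SmoothInd H σ') = ⊤ := congrArg Subrepresentation.toSubmodule h1
    apply Subrepresentation.toSubmodule_injective
    refine eq_top_iff.2 fun f _ => ?_
    have hf : Φ f ∈ N.toSubmodule.map (Φ : SmoothInd H σ →ₗ[k] SmoothInd H σ') := by rw [h1']; exact Submodule.mem_top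
    obtain ⟨n, hn, hnf⟩ := Submodule.mem_map.1 hf
    rw [LinearEquiv.coe_coe] at hnf
    rwa [← Φ.injective hnf]

/-- **Twisting by a character of `G` preserves «reducible»** (both directions; the inverse equivalence is the twist by `ψ⁻¹`). [cite: BushnellHenniart2006, §9.1]
[cite: BernsteinZelevinsky1977, §2.3, Prop. 1.9 (f)] -/
theorem exists_ne_bot_ne_top_iff_of_twist (hψ : IsOpen ((ψ.ker : Subgroup G) : Set G)) (hσ : ∀ (h : H) (w : W), σ' h w = ((ψ (h : G) : kˣ) : k) • σ h w) :
    (∃ N : Subrepresentation (smoothIndRep H σ), N ≠ ⊥ ∧ N ≠ ⊤) ↔ ∃ N' : Subrepresentation (smoothIndRep H σ'), N' ≠ ⊥ ∧ N' ≠ ⊤ := by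
  obtain ⟨Φ, hΦ⟩ := exists_twistEquiv H ψ hψ hσ
  have hΦ' : ∀ (f : SmoothInd H σ') (g : G), (Φ.symm f).toFun g = ((ψ⁻¹ g : kˣ) : k) • f.toFun g := fun f g => by
    have h := hΦ (Φ.symm f) g
    rw [LinearEquiv.apply_symm_apply] at h
    rw [h, smul_smul, MonoidHom.inv_apply, Units.inv_mul, one_smul]
  exact ⟨exists_ne_bot_ne_top_of_twist H ψ Φ hΦ, exists_ne_bot_ne_top_of_twist H ψ⁻¹ Φ.symm hΦ'⟩

end Generic

/-! ## §2 `U(Φ₃)(L⁺_v)`: `i_G(χ₁, χ₂)` reducible ⟺ `i_G(χ₁, χ₂ψ)` reducible ⟺ `i_G(χ₁, 1)` reducible -/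

variable (L : Type) [Field L] [NumberField L] [IsCMField L] (v : HeightOneSpectrum (𝓞 ↥(maximalRealSubfield L)))

set_option synthInstance.maxHeartbeats 400000 in
set_option maxHeartbeats 8000000 in
-- `cmPrincipalSeries` unfolds to `smoothIndRep` on the Borel (class of ★ `F0P3cStCharTSStOneDim.exists_intertwiningMap_ofChar_stChar`)
/-- **`i_G(χ₁, χ₂)` IS REDUCIBLE ⟺ `i_G(χ₁, χ₂·ψ)` IS REDUCIBLE** for every continuous character `ψ` of `E¹_v` (`G = U(Φ₃)(L⁺_v)`, any finite `v`, any `χ₁, χ₂`): with `d = det_G`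
(★ `exists_detNormOne`) the character `ψ∘d` of `G` has open kernel (★ `isOpen_ker_comp`) and on the Borel `(χ₁, χ₂ψ)(proj p)·δ^{1∕2}(p) = ψ(d p) · (χ₁, χ₂)(proj p)·δ^{1∕2}(p)`
(★ `torusCharPair_apply`, `d p = det(proj p)` ★ `det_proj`), so §1 applies: `i_G(χ₁, χ₂ψ) = i_G(χ₁, χ₂) ⊗ (ψ∘det_G)`. [cite: Rogawski1990, §12.1 p. 171; §12.2 p. 173]
[cite: BernsteinZelevinsky1977, §2.3, Prop. 1.9 (f)] -/
theorem reducible_iff_reducible_twist (χ₁ : (UnitaryGroup.LocalRing L v)ˣ →* ℂˣ) (χ₂ ψ : ↥(normOneUnits (conjLocal L (IsCMField.complexConj L) v)) →* ℂˣ)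
    (hψ : Continuous ψ) :
    (∃ N : Subrepresentation (cmPrincipalSeries L 3 v (cmTorusCharPair L v χ₁ χ₂)), N ≠ ⊥ ∧ N ≠ ⊤) ↔
      ∃ N : Subrepresentation (cmPrincipalSeries L 3 v (cmTorusCharPair L v χ₁ (χ₂ * ψ))), N ≠ ⊥ ∧ N ≠ ⊤ := by
  haveI := locallyCompactSpace_cmBorelU L 3 v
  obtain ⟨d, hd, hdc⟩ := F0P3cStCharTSStOneDim.exists_detNormOne L v
  have hker := F0P3cStCharTSStOneDim.isOpen_ker_comp L v ψ hψ d hdc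
  -- `ψ ∘ d` restricted to the Borel: `σ_{χ₁, χ₂ψ}(p) = ψ(d p) · σ_{χ₁, χ₂}(p)`
  have hσ : ∀ (p : ↥(cmBorelTriple L 3 v).P) (w : ℂ),
      (Representation.twist (((Representation.trivial ℂ ↥(torusU (conjLocal L (IsCMField.complexConj L) v) (cmLocalForm L 3 v)) ℂ).twist
        (cmTorusCharPair L v χ₁ (χ₂ * ψ))).comp (cmBorelTriple L 3 v).proj) (rootDeltaChar (cmBorelTriple L 3 v).P)) p w =
      (((ψ.comp d) (p : ↥(unitaryGroupOfForm (conjLocal L (IsCMField.complexConj L) v) (cmLocalForm L 3 v))) : ℂˣ) : ℂ) •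
        (Representation.twist (((Representation.trivial ℂ ↥(torusU (conjLocal L (IsCMField.complexConj L) v) (cmLocalForm L 3 v)) ℂ).twist
          (cmTorusCharPair L v χ₁ χ₂)).comp (cmBorelTriple L 3 v).proj) (rootDeltaChar (cmBorelTriple L 3 v).P)) p w := by
    intro p w
    -- `d p = det (proj p)` in `E¹_v`
    have hdet : d (p : ↥(unitaryGroupOfForm (conjLocal L (IsCMField.complexConj L) v) (cmLocalForm L 3 v))) =
        torusDetNormOne (conjLocal L (IsCMField.complexConj L) v) (cmLocalForm L 3 v) (cmLocalForm_eq_over L 3 v) ((cmBorelTriple L 3 v).proj p) := by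
      rw [F0P3cStCharTSStOneDim.det_proj L v d hd p]
      apply Subtype.ext
      apply Units.ext
      rw [hd, Matrix.GeneralLinearGroup.val_det_apply, coe_torusDetNormOne, coe_torusDet]
    have hχ : cmTorusCharPair L v χ₁ (χ₂ * ψ) ((cmBorelTriple L 3 v).proj p) =
        cmTorusCharPair L v χ₁ χ₂ ((cmBorelTriple L 3 v).proj p) * ψ (d (p : ↥(unitaryGroupOfForm (conjLocal L (IsCMField.complexConj L) v) (cmLocalForm L 3 v)))) := by
      rw [hdet]
      simp only [cmTorusCharPair, torusCharPair_apply, MonoidHom.mul_apply, mul_assoc]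
    simp only [Representation.twist_apply, MonoidHom.comp_apply, Representation.trivial_apply, smul_eq_mul, hχ, Units.val_mul]
    ring
  exact exists_ne_bot_ne_top_iff_of_twist (cmBorelTriple L 3 v).P (ψ.comp d) hker hσ

set_option synthInstance.maxHeartbeats 400000 in
set_option maxHeartbeats 8000000 in
-- two `cmPrincipalSeries` carriers in the statement (class of §2's first theorem)
/-- **`i_G(χ₁, χ₂)` IS REDUCIBLE ⟺ `i_G(χ₁, 1)` IS REDUCIBLE** (`ψ = χ₂⁻¹` in `reducible_iff_reducible_twist`; `χ₂` continuous).  Consequence for U4-f: its conclusion (about `χ₁` only) may be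
proved for `(χ₁, 1)`, whose `i_G` is `K_v`-spherical as soon as `χ₁` is unramified (roads I ∕ II). [cite: Rogawski1990, §12.2 p. 173] [cite: Keys1984, §7] -/
theorem reducible_iff_reducible_one (χ₁ : (UnitaryGroup.LocalRing L v)ˣ →* ℂˣ) (χ₂ : ↥(normOneUnits (conjLocal L (IsCMField.complexConj L) v)) →* ℂˣ)
    (h₂ : Continuous fun x => ((χ₂ x : ℂˣ) : ℂ)) :
    (∃ N : Subrepresentation (cmPrincipalSeries L 3 v (cmTorusCharPair L v χ₁ χ₂)), N ≠ ⊥ ∧ N ≠ ⊤) ↔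
      ∃ N : Subrepresentation (cmPrincipalSeries L 3 v (cmTorusCharPair L v χ₁ 1)), N ≠ ⊥ ∧ N ≠ ⊤ := by
  have hψ : Continuous (χ₂⁻¹ : ↥(normOneUnits (conjLocal L (IsCMField.complexConj L) v)) →* ℂˣ) := by
    have hc : Continuous (χ₂ : ↥(normOneUnits (conjLocal L (IsCMField.complexConj L) v)) → ℂˣ) :=
      Units.continuous_iff.2 ⟨h₂, (h₂.inv₀ fun x => Units.ne_zero _).congr fun x => by simp⟩
    exact hc.inv
  have hχ : χ₂ * χ₂⁻¹ = 1 := MonoidHom.ext fun x => by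
    rw [MonoidHom.mul_apply, MonoidHom.inv_apply, mul_inv_cancel, MonoidHom.one_apply]
  have h := reducible_iff_reducible_twist L v χ₁ χ₂ χ₂⁻¹ hψ
  rwa [hχ] at h

end Summit.HodgeConjecture.HodgeConjecture.Cruxes.H413.K2E3PrincipalSeriesDetTwist

end
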